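import Summits.CriticalPhenomena.PercolationContinuityZ3.Theorems.SahiMasterFamilyFourStep
import Summits.CriticalPhenomena.PercolationContinuityZ3.Theorems.SahiMasterFamilyFrame
import Summits.CriticalPhenomena.PercolationContinuityZ3.Theorems.SahiMasterFamilyZeroFamilies

/-!
# The master conjecture on an independent frame plus one event — EVERY order, both halves

Unit `prim-master-conj` (crux anchor stmt-CriticalPhenomena-4575).  `SahiMasterFamilyFrame.lean` proves the positivity
`E_{n+2}(μ_p; 1_{F_0},…,1_{F_{n+1}}) ≥ 0` whenever the increasing events `F_j`, `j ≠ s`, have pairwise disjoint essential supports (an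
**independent frame** `(F_j)_{j ≠ s}` plus ONE arbitrary increasing event `F_s`), at every order.  This file proves the EQUALITY half
at every order, from the tree's identity `E_{n+2}(F) = n!·Σ_{j≠s} Cov(F_j, Π_{l≠j} F_l)`
(`Literature.Combinatorics.Sahi2008.sahiE_eq_sum_cov_of_indepMoments`) and strict Harris:
* `disjoint_of_sahiE_frame_eq_zero` — for `p` in the open cube, `E_{n+2}(μ_p; 1_F) = 0` forces, for every frame slot `j ≠ s`,
  `esupp(F_j) ∩ esupp(⋂_{l≠j} F_l) = ∅` (the free event meets each `(n)`-fold intersection of frame members only off the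
  support of the remaining member);
* `suppZeroFlag_of_frame_of_disjoint` — conversely these support conditions put `F` in the zero-flag class `Z_{n+2}` (induction on
  the order: the conditions are inherited verbatim by every modified family of the peel at `s`);
* `sahiE_ind_eq_zero_iff_of_frame` — hence **`E_{n+2}(μ_p; 1_F) = 0 ↔ F ∈ Z_{n+2}`** on such families, every order, every
  interior `p`; with `sahiE_ind_nonneg_of_frame` this is the step of the master conjecture (`masterFamily_step`) on a frame core
  with no lower-order input (`masterFamily_step_frame`), and `suppZeroFlag_iff_disjoint_of_frame` is the explicit description of
  `Z_{n+2}` there.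
Orders `3` (independent pair), `4`, `5` are special cases of the tree's step theorems; the point here is uniformity in the order.
No conjecture asserted; axioms standard. [this work]
-/

noncomputable section

open scoped Classical

namespace Summit.CriticalPhenomena.PercolationContinuityZ3.Theorems

open Finset Function MeasureTheory
open Literature.Combinatorics.Sahi2008
open Literature.Probability.Percolation (DeterminedBy)
open Literature.Probability.LatticeModels (prodBernoulli prodBernoulli_harris)
open Literature.Probability.Percolation.DecisionTree (ind ind_of_mem ind_of_not_mem ind_nonneg)

variable {ι : Type*} [Fintype ι]

/-! ### Set bookkeeping -/

omit [Fintype ι] in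
/-- The intersection of the members other than `j` is increasing. [folklore] -/
theorem isUpperSet_biInter_erase {m : ℕ} {F : Fin m → Set (Set ι)} (hF : ∀ j, IsUpperSet (F j)) (S : Finset (Fin m)) :
    IsUpperSet (⋂ l ∈ S, F l) :=
  isUpperSet_iInter fun l => isUpperSet_iInter fun _ => hF l

omit [Fintype ι] in
/-- On `Fin 2`, the intersection of the members other than `j` is the other member. [folklore] -/
theorem biInter_erase_fin_two (F : Fin 2 → Set (Set ι)) (j : Fin 2) :
    (⋂ l ∈ (univ.erase j : Finset (Fin 2)), F l) = F (j.succAbove 0) := by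
  ext ω
  simp only [Set.mem_iInter, mem_erase, mem_univ, and_true]
  constructor
  · intro h; exact h _ (Fin.succAbove_ne j 0)
  · intro h l hl
    obtain ⟨z, hz⟩ := Fin.exists_succAbove_eq hl
    rw [← hz, Fin.eq_zero z]; exact h

omit [Fintype ι] in
/-- **The support conditions are inherited by the modified families**: for `j ≠ l` in the deleted index set, the intersection of
the members other than `j` of `F_{−s}` with slot `l` intersected with `F_s` is the intersection of the members of `F` other than
`s.succAbove j`. [this work] -/
theorem biInter_erase_update_inter {n : ℕ} (F : Fin (n + 3) → Set (Set ι)) (s : Fin (n + 3)) (l j : Fin (n + 2)) (hjl : j ≠ l) :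
    (⋂ q ∈ (univ.erase j : Finset (Fin (n + 2))), update (fun q => F (s.succAbove q)) l (F (s.succAbove l) ∩ F s) q) =
      ⋂ r ∈ (univ.erase (s.succAbove j) : Finset (Fin (n + 3))), F r := by
  ext ω
  simp only [Set.mem_iInter, mem_erase, mem_univ, and_true]
  constructor
  · intro h r hr
    by_cases hrs : r = s
    · have hl := h l hjl.symm
      rw [update_self] at hl
      rw [hrs]; exact hl.2
    · obtain ⟨q, hq⟩ := Fin.exists_succAbove_eq hrs
      have hqj : q ≠ j := fun h' => hr (by rw [← hq, h'])
      have hq' := h q hqj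
      by_cases hql : q = l
      · subst hql; rw [update_self] at hq'; rw [← hq]; exact hq'.1
      · rw [update_of_ne hql] at hq'; rw [← hq]; exact hq'
  · intro h q hq
    by_cases hql : q = l
    · subst hql
      rw [update_self]
      exact ⟨h _ fun h' => hq (Fin.succAbove_right_injective h'), h _ (Fin.succAbove_ne s j).symm⟩
    · rw [update_of_ne hql]
      exact h _ fun h' => hq (Fin.succAbove_right_injective h')

/-! ### Zero ⇒ support conditions -/

omit [Fintype ι] in
/-- The product of the indicators other than slot `j` is the indicator of the intersection of the other members. [folklore] -/
theorem prod_update_ind_one {m : ℕ} (F : Fin m → Set (Set ι)) (j : Fin m) :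
    (∏ l, update (fun l => ind (F l)) j 1 l) = ind (⋂ l ∈ (univ.erase j : Finset (Fin m)), F l) := by
  rw [prod_update_one_eq_prod_erase]
  exact prod_ind_eq_ind_biInter F (univ.erase j)

/-- **Zero ⇒ support conditions, every order.**  For increasing events `F_j` whose members off the slot `s` have pairwise disjoint
essential supports and `p` in the open cube, `E_{n+2}(μ_p; 1_F) = 0` forces `esupp(F_j) ∩ esupp(⋂_{l≠j} F_l) = ∅` for every `j ≠ s`
(each Harris covariance of the frame identity vanishes; strict Harris). [this work] -/
theorem disjoint_of_sahiE_frame_eq_zero (p : ι → unitInterval) (hp : ∀ e, (p e : ℝ) ∈ Set.Ioo (0 : ℝ) 1) {n : ℕ}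
    (F : Fin (n + 2) → Set (Set ι)) (hF : ∀ j, IsUpperSet (F j)) (s : Fin (n + 2))
    (hd : ∀ j j', j ≠ s → j' ≠ s → j ≠ j' → Disjoint (esupp (F j)) (esupp (F j')))
    (h0 : sahiE (bernoulliWeight p) (n + 2) (fun j => ind (F j)) = 0) :
    ∀ j, j ≠ s → Disjoint (esupp (F j)) (esupp (⋂ l ∈ (univ.erase j : Finset (Fin (n + 2))), F l)) := by
  have hmom : ∀ S : Finset (Fin (n + 2)), s ∉ S →
      ex (bernoulliWeight p) (∏ j ∈ S, (fun j => ind (F j)) j) = ∏ j ∈ S, ex (bernoulliWeight p) ((fun j => ind (F j)) j) := by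
    intro S hs
    refine ex_prod_ind_eq_prod_ex p F (fun j => esupp (F j)) S (fun j _ => determinedBy_esupp (hF j)) ?_
    intro j hj j' hj' hne
    exact hd j j' (fun h => hs (h ▸ hj)) (fun h => hs (h ▸ hj')) hne
  rw [sahiE_eq_sum_cov_of_indepMoments (bernoulliWeight p) n _ s hmom] at h0
  -- each covariance in events form
  have hcov : ∀ j, ex (bernoulliWeight p) (ind (F j) * ∏ l, update (fun j => ind (F j)) j 1 l) -
      ex (bernoulliWeight p) (ind (F j)) * ex (bernoulliWeight p) (∏ l, update (fun j => ind (F j)) j 1 l) =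
      (prodBernoulli p).real (F j ∩ ⋂ l ∈ (univ.erase j : Finset (Fin (n + 2))), F l) -
        (prodBernoulli p).real (F j) * (prodBernoulli p).real (⋂ l ∈ (univ.erase j : Finset (Fin (n + 2))), F l) := by
    intro j
    have hmul : ind (F j) * ind (⋂ l ∈ (univ.erase j : Finset (Fin (n + 2))), F l) =
        ind (F j ∩ ⋂ l ∈ (univ.erase j : Finset (Fin (n + 2))), F l) := by
      funext ω; exact (Literature.Probability.Percolation.BHK2006.ind_inter _ _ ω).symm
    simp only [prod_update_ind_one]
    rw [hmul, ex_bernoulliWeight_ind, ex_bernoulliWeight_ind, ex_bernoulliWeight_ind]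
  have hnn : ∀ j ∈ univ.erase s, 0 ≤ ex (bernoulliWeight p) (ind (F j) * ∏ l, update (fun j => ind (F j)) j 1 l) -
      ex (bernoulliWeight p) (ind (F j)) * ex (bernoulliWeight p) (∏ l, update (fun j => ind (F j)) j 1 l) := by
    intro j _
    rw [hcov j]
    have := prodBernoulli_harris p (hF j) (isUpperSet_biInter_erase hF (univ.erase j)) MeasurableSet.of_discrete
      MeasurableSet.of_discrete
    linarith
  have hfac : (n.factorial : ℝ) ≠ 0 := by exact_mod_cast n.factorial_ne_zero
  have hsum := (sum_eq_zero_iff_of_nonneg hnn).1 ((mul_eq_zero.1 h0).resolve_left hfac)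
  intro j hj
  have hz := hsum j (mem_erase.2 ⟨hj, mem_univ j⟩)
  rw [hcov j] at hz
  exact disjoint_esupp_of_real_inter_eq p hp (hF j) (isUpperSet_biInter_erase hF (univ.erase j)) (by linarith)

/-! ### Support conditions ⇒ zero flag -/

/-- **Support conditions ⇒ `Z_{n+2}`, every order**: if the increasing events off slot `s` have pairwise disjoint essential supports
and `esupp(F_j) ∩ esupp(⋂_{l≠j} F_l) = ∅` for every `j ≠ s`, then `F ∈ Z_{n+2}` — peel at `s`: the deleted family is an independent
frame (`suppZeroFlag_of_pairwise_disjoint`), and every modified family `F_{−s}` with `F_l ↦ F_l ∩ F_s` is again a frame plus one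
event satisfying the same conditions (`biInter_erase_update_inter`). [this work] -/
theorem suppZeroFlag_of_frame_of_disjoint :
    ∀ (n : ℕ) (F : Fin (n + 2) → Set (Set ι)) (s : Fin (n + 2)), (∀ j, IsUpperSet (F j)) →
      (∀ j j', j ≠ s → j' ≠ s → j ≠ j' → Disjoint (esupp (F j)) (esupp (F j'))) →
      (∀ j, j ≠ s → Disjoint (esupp (F j)) (esupp (⋂ l ∈ (univ.erase j : Finset (Fin (n + 2))), F l))) →
      SuppZeroFlag (n + 2) F
  | 0, F, s, hF, _, hc => by
    have key : ∀ t : Fin 2, t ≠ s → Disjoint (esupp (F t)) (esupp (F (t.succAbove 0))) := fun t ht => by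
      have h := hc t ht
      rwa [biInter_erase_fin_two] at h
    rw [suppZeroFlag_two_eta]
    fin_cases s
    · have h := key 1 (by decide)
      have e : (1 : Fin 2).succAbove 0 = 0 := by decide
      rw [e] at h
      exact suppZeroFlag_two_symm ((suppZeroFlag_two_iff (hF 1) (hF 0)).2 h)
    · have h := key 0 (by decide)
      have e : (0 : Fin 2).succAbove 0 = 1 := by decide
      rw [e] at h
      exact (suppZeroFlag_two_iff (hF 0) (hF 1)).2 h
  | n + 1, F, s, hF, hd, hc => by
    refine ⟨s, ?_, fun l => ?_⟩
    · exact suppZeroFlag_of_pairwise_disjoint n (fun j => F (s.succAbove j)) (fun j => esupp (F (s.succAbove j)))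
        (fun i j hij => hd _ _ (Fin.succAbove_ne s i) (Fin.succAbove_ne s j)
          fun h => hij (Fin.succAbove_right_injective h))
        fun j => determinedBy_esupp (hF _)
    · refine suppZeroFlag_of_frame_of_disjoint n _ l (isUpperSet_update_inter hF s l) ?_ ?_
      · intro j j' hj hj' hjj'
        rw [update_of_ne hj, update_of_ne hj']
        exact hd _ _ (Fin.succAbove_ne s j) (Fin.succAbove_ne s j') fun h => hjj' (Fin.succAbove_right_injective h)
      · intro j hj
        rw [update_of_ne hj, biInter_erase_update_inter F s l j hj]
        exact hc (s.succAbove j) (Fin.succAbove_ne s j)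

/-! ### The step on a frame core, every order -/

/-- **(EQ) on an independent frame plus one event, every order** (`p` in the open cube): if the increasing events `F_j`, `j ≠ s`,
have pairwise disjoint essential supports then `E_{n+2}(μ_p; 1_{F_0},…,1_{F_{n+1}}) = 0 ↔ F ∈ Z_{n+2}`. [this work] -/
theorem sahiE_ind_eq_zero_iff_of_frame (p : ι → unitInterval) (hp : ∀ e, (p e : ℝ) ∈ Set.Ioo (0 : ℝ) 1) {n : ℕ}
    (F : Fin (n + 2) → Set (Set ι)) (hF : ∀ j, IsUpperSet (F j)) (s : Fin (n + 2))
    (hd : ∀ j j', j ≠ s → j' ≠ s → j ≠ j' → Disjoint (esupp (F j)) (esupp (F j'))) :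
    sahiE (bernoulliWeight p) (n + 2) (fun j => ind (F j)) = 0 ↔ SuppZeroFlag (n + 2) F :=
  ⟨fun h0 => suppZeroFlag_of_frame_of_disjoint n F s hF hd (disjoint_of_sahiE_frame_eq_zero p hp F hF s hd h0),
    fun h => sahiE_ind_eq_zero_of_suppZeroFlag p h⟩

/-- **The zero-flag class on frame cores, explicitly**: for increasing `F_j` with `(F_j)_{j≠s}` an independent frame,
`F ∈ Z_{n+2} ↔ ∀ j ≠ s, esupp(F_j) ∩ esupp(⋂_{l≠j} F_l) = ∅`. [this work] -/
theorem suppZeroFlag_iff_disjoint_of_frame {n : ℕ} (F : Fin (n + 2) → Set (Set ι)) (hF : ∀ j, IsUpperSet (F j))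
    (s : Fin (n + 2)) (hd : ∀ j j', j ≠ s → j' ≠ s → j ≠ j' → Disjoint (esupp (F j)) (esupp (F j'))) :
    SuppZeroFlag (n + 2) F ↔
      ∀ j, j ≠ s → Disjoint (esupp (F j)) (esupp (⋂ l ∈ (univ.erase j : Finset (Fin (n + 2))), F l)) :=
  ⟨fun h => disjoint_of_sahiE_frame_eq_zero (halfParams ι) (halfParams_mem_Ioo ι) F hF s hd
      (sahiE_ind_eq_zero_of_suppZeroFlag _ h),
    fun h => suppZeroFlag_of_frame_of_disjoint n F s hF hd h⟩

/-- **The step of the master conjecture on a frame core, every order, unconditionally**: positivity for every `p ∈ [0,1]^ι` and,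
in the open cube, `E_{n+2} = 0 ↔ Z_{n+2}` — `masterFamily_step` for families whose zero-flag sub-family is an independent frame, with
no hypothesis of lower order. [this work] -/
theorem masterFamily_step_frame (p : ι → unitInterval) (hp : ∀ e, (p e : ℝ) ∈ Set.Ioo (0 : ℝ) 1) {n : ℕ}
    (F : Fin (n + 2) → Set (Set ι)) (hF : ∀ j, IsUpperSet (F j)) (s : Fin (n + 2))
    (hd : ∀ j j', j ≠ s → j' ≠ s → j ≠ j' → Disjoint (esupp (F j)) (esupp (F j'))) :
    0 ≤ sahiE (bernoulliWeight p) (n + 2) (fun j => ind (F j)) ∧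
      (sahiE (bernoulliWeight p) (n + 2) (fun j => ind (F j)) = 0 ↔ SuppZeroFlag (n + 2) F) :=
  ⟨sahiE_ind_nonneg_of_frame p F hF s hd, sahiE_ind_eq_zero_iff_of_frame p hp F hF s hd⟩

end Summit.CriticalPhenomena.PercolationContinuityZ3.Theorems
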